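import Mathlib.Analysis.Calculus.Deriv.Shift
import Mathlib.Analysis.Calculus.MeanValue
import Mathlib.Analysis.Calculus.TangentCone.Real
import Literature.Analysis.FluidPDE.ClassicalSolution
import HarnessLib

/-!
# Time translation and gluing of classical Navier–Stokes solutions

Analysis/FluidPDE support file (glue for the continuation criteria of
`Literature.Analysis.FluidPDE.NSCriticalClosure`). Two elementary operations on classical
solutions `Literature.Fluid.IsClassicalNSSolutionOn S ν f u p` (Fefferman's (1), (2), (6); jointly
`C^∞` velocity and pressure, momentum equation with the one-sided time derivative within the
time set `S`):

* **time translation** `u ↦ u(· + a)`: a classical solution on `S` is a classical solution on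
  `(· + a)⁻¹' S` with translated force and pressure (`IsClassicalNSSolutionOn.comp_add_right`,
  `IsClassicalNSSolutionOn.translate_Ico`); the system is autonomous;
* **gluing along an open overlap**: if `(u₁, p₁)` is classical on `[0, T)`, `(u₂, p₂)` is
  classical on `(a, b)` with `0 ≤ a < T ≤ b`, and `u₁ = u₂` on `(a, T)`, then the field equal to
  `u₁` before `T` and to `u₂` from `T` on is a classical solution on `[0, b)`
  (`IsClassicalNSSolutionOn.glue`). Only the velocities are assumed to agree: the momentum
  equations then force `∇p₁ = ∇p₂` on the overlap (`gradient_pressure_eq_of_eventuallyEq`), so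
  the pressures agree there up to a function of time alone, and the *normalised* pressures
  `pᵢ(t, x) - pᵢ(t, 0)` glue smoothly. Smoothness of the glued fields is local
  (Mathlib `contDiffOn_of_locally_contDiffOn`), the two pieces `[0, T)` and `(a, b)` being
  relatively open in `[0, b)`.

Consequence (`HasSmoothExtensionPast.of_translate`, `IsMaximalSmoothSolution.translate`): if the
translate `u(· + s)`, `0 < s < T`, of a classical solution on `[0, T)` extends smoothly past
`T - s`, then `u` extends smoothly past `T` (Beale–Kato–Majda 1984, §1, continuation
vocabulary `HasSmoothExtensionPast` / `IsMaximalSmoothSolution` of `ClassicalSolution.lean`); so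
maximality of the lifespan is inherited by time translates. This is the form in which blow-up
criteria stated for maximal smooth solutions (`NS.leray_blowup_rate_top`, `NS.seregin_L3_blowup`)
are applied after discarding an initial layer `[0, s]`.

All statements are folklore bookkeeping; no analysis beyond the mean value theorem
(`is_const_of_fderiv_eq_zero`) is used.

## References

* J. T. Beale, T. Kato, A. Majda, *Remarks on the breakdown of smooth solutions for the 3-D
  Euler equations*, Comm. Math. Phys. 94 (1984), §1 (maximal interval of smooth existence).
* C. L. Fefferman, *Existence and smoothness of the Navier–Stokes equation* (Clay, 2000/2006),
  (1), (2), (6).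
-/

noncomputable section

open Set Function Filter Topology
open scoped ContDiff Laplacian InnerProductSpace RealInnerProductSpace Pointwise

namespace Literature.Analysis.FluidPDE

/-! ### Time translation -/

section Translate

variable {X : Type*} [NormedAddCommGroup X] [NormedSpace ℝ X]
variable {F : Type*} [NormedAddCommGroup F] [NormedSpace ℝ F]

/-- `a + ((· + a)⁻¹' S) = S` (translation of a preimage under translation). [folklore] -/
theorem vadd_set_preimage_add_right (a : ℝ) (S : Set ℝ) : a +ᵥ ((· + a) ⁻¹' S) = S := by
  ext t
  simp only [Set.mem_vadd_set, mem_preimage, vadd_eq_add]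
  constructor
  · rintro ⟨y, hy, rfl⟩
    rwa [add_comm]
  · intro ht
    exact ⟨t - a, by simpa using ht, by ring⟩

/-- Joint smoothness is invariant under time translation: if `w` is jointly smooth on `S × X`
then `w(· + a)` is jointly smooth on `((· + a)⁻¹' S) × X`. [folklore] -/
theorem IsSmoothSpaceTimeOn.comp_add_right {S : Set ℝ} {w : ℝ → X → F}
    (h : IsSmoothSpaceTimeOn S w) (a : ℝ) :
    IsSmoothSpaceTimeOn ((· + a) ⁻¹' S) (fun t => w (t + a)) := by
  have hφ : ContDiff ℝ ∞ (fun z : ℝ × X => (z.1 + a, z.2)) :=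
    (contDiff_fst.add contDiff_const).prodMk contDiff_snd
  have hmaps : MapsTo (fun z : ℝ × X => (z.1 + a, z.2)) (((· + a) ⁻¹' S) ×ˢ univ) (S ×ˢ univ) :=
    fun z hz => ⟨hz.1, mem_univ _⟩
  change ContDiffOn ℝ ∞ (uncurry w ∘ fun z : ℝ × X => (z.1 + a, z.2)) (((· + a) ⁻¹' S) ×ˢ univ)
  exact h.comp hφ.contDiffOn hmaps

/-- Subtracting the value at the spatial origin preserves joint smoothness:
`(t, x) ↦ p(t, x) - p(t, 0)` is jointly smooth when `p` is (the normalised pressure used in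
gluing). [folklore] -/
theorem IsSmoothSpaceTimeOn.sub_apply_zero {S : Set ℝ} {p : ℝ → X → F}
    (h : IsSmoothSpaceTimeOn S p) : IsSmoothSpaceTimeOn S (fun t x => p t x - p t 0) := by
  have h0 : ContDiffOn ℝ ∞ (fun z : ℝ × X => uncurry p (z.1, (0 : X))) (S ×ˢ univ) :=
    h.comp (contDiff_fst.prodMk contDiff_const).contDiffOn fun z hz => ⟨hz.1, mem_univ _⟩
  exact ContDiffOn.sub h h0

omit [NormedAddCommGroup X] [NormedSpace ℝ X] in
/-- The one-sided time derivative commutes with time translation: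
`∂ₜ[u(· + a)]` within `(· + a)⁻¹' S` at `t` is `∂ₜu` within `S` at `t + a`
(Mathlib `derivWithin_comp_add_const`). [folklore] -/
theorem timeDerivWithin_comp_add_right (S : Set ℝ) (w : ℝ → X → F) (a t : ℝ) (x : X) :
    timeDerivWithin ((· + a) ⁻¹' S) (fun s => w (s + a)) t x = timeDerivWithin S w (t + a) x := by
  simp only [timeDerivWithin_apply]
  rw [show (fun s => w (s + a) x) = ((fun s => w s x) <| · + a) from rfl,
    derivWithin_comp_add_const (fun s => w s x) a, vadd_set_preimage_add_right]

variable {E : Type*} [NormedAddCommGroup E] [InnerProductSpace ℝ E] [FiniteDimensional ℝ E]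
variable {S : Set ℝ} {ν : ℝ} {f u : ℝ → E → E} {p : ℝ → E → ℝ}

/-- **Time translation of classical solutions.** The Navier–Stokes system is autonomous: if
`(u, p)` is a classical solution with force `f` on the time set `S`, then
`(u(· + a), p(· + a))` is a classical solution with force `f(· + a)` on `(· + a)⁻¹' S`
(Fefferman (1), (2), (6) are pointwise in `t`; the one-sided time derivative translates by
`timeDerivWithin_comp_add_right`). [folklore] -/
theorem IsClassicalNSSolutionOn.comp_add_right (h : IsClassicalNSSolutionOn S ν f u p) (a : ℝ) :
    IsClassicalNSSolutionOn ((· + a) ⁻¹' S) ν (fun t => f (t + a)) (fun t => u (t + a))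
      (fun t => p (t + a)) where
  smooth_velocity := h.smooth_velocity.comp_add_right a
  smooth_pressure := h.smooth_pressure.comp_add_right a
  momentum t ht x := by
    rw [timeDerivWithin_comp_add_right]
    exact h.momentum (t + a) ht x
  divFree t ht := h.divFree (t + a) ht

/-- **Time translation on `[0, T)`.** A classical solution on `[0, T)` translated by
`s ≥ 0` is a classical solution on `[0, T - s)` (restrict `comp_add_right` from
`(· + s)⁻¹' [0, T) = [-s, T - s)` to `[0, T - s)`, a set of unique differentiability; the
conclusion is void unless `s < T`). [folklore] -/
theorem IsClassicalNSSolutionOn.translate_Ico {T s : ℝ}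
    (h : IsClassicalNSSolutionOn (Ico 0 T) ν f u p) (hs : 0 ≤ s) :
    IsClassicalNSSolutionOn (Ico 0 (T - s)) ν (fun t => f (t + s)) (fun t => u (t + s))
      (fun t => p (t + s)) :=
  (h.comp_add_right s).mono (fun t ht => ⟨by linarith [ht.1], by linarith [ht.2]⟩)
    (uniqueDiffOn_Ico 0 (T - s))

end Translate

/-! ### Gluing along an open overlap -/

section Glue

variable {E : Type*} [NormedAddCommGroup E] [InnerProductSpace ℝ E] [FiniteDimensional ℝ E]
variable {ν : ℝ}

/-- The gradient ignores additive constants: `∇(g - c) = ∇g` (Mathlib `fderiv_sub_const`). [folklore] -/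
theorem gradient_sub_const (g : E → ℝ) (c : ℝ) (x : E) :
    gradient (fun y => g y - c) x = gradient g x := by
  unfold gradient
  rw [fderiv_sub_const]

/-- **The velocity determines the pressure gradient.** If two classical solutions (same `ν`,
same force) have velocities agreeing near the time `t`, interior to both time sets, then their
pressure gradients agree at time `t`: `∇p₁(t, ·) = ∇p₂(t, ·)` (subtract the two momentum
equations; the time derivatives at an interior time are two-sided and agree for fields that
coincide near `t`). [folklore] -/
theorem IsClassicalNSSolutionOn.gradient_pressure_eq_of_eventuallyEq {S₁ S₂ : Set ℝ}
    {f u₁ u₂ : ℝ → E → E} {p₁ p₂ : ℝ → E → ℝ} (h₁ : IsClassicalNSSolutionOn S₁ ν f u₁ p₁)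
    (h₂ : IsClassicalNSSolutionOn S₂ ν f u₂ p₂) {t : ℝ} (ht₁ : S₁ ∈ 𝓝 t) (ht₂ : S₂ ∈ 𝓝 t)
    (heq : ∀ᶠ τ in 𝓝 t, u₁ τ = u₂ τ) (x : E) : gradient (p₁ t) x = gradient (p₂ t) x := by
  have heqt : u₁ t = u₂ t := heq.self_of_nhds
  have hd : timeDerivWithin S₁ u₁ t x = timeDerivWithin S₂ u₂ t x := by
    simp only [timeDerivWithin_apply]
    rw [derivWithin_of_mem_nhds ht₁, derivWithin_of_mem_nhds ht₂]
    exact Filter.EventuallyEq.deriv_eq (heq.mono fun τ hτ => congrFun hτ x)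
  have hm₁ := h₁.momentum t (mem_of_mem_nhds ht₁) x
  have hm₂ := h₂.momentum t (mem_of_mem_nhds ht₂) x
  rw [hd, heqt] at hm₁
  have h12 := hm₁.symm.trans hm₂
  simpa using h12

/-- **Pressures with the same velocity differ by a function of time.** Under the hypotheses of
`gradient_pressure_eq_of_eventuallyEq`, `p₁(t, x) - p₁(t, 0) = p₂(t, x) - p₂(t, 0)` for all `x`
(a `C¹` function on `E` with vanishing derivative is constant, Mathlib
`is_const_of_fderiv_eq_zero`). [folklore] -/
theorem IsClassicalNSSolutionOn.pressure_sub_apply_zero_eq_of_eventuallyEq {S₁ S₂ : Set ℝ}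
    {f u₁ u₂ : ℝ → E → E} {p₁ p₂ : ℝ → E → ℝ} (h₁ : IsClassicalNSSolutionOn S₁ ν f u₁ p₁)
    (h₂ : IsClassicalNSSolutionOn S₂ ν f u₂ p₂) {t : ℝ} (ht₁ : S₁ ∈ 𝓝 t) (ht₂ : S₂ ∈ 𝓝 t)
    (heq : ∀ᶠ τ in 𝓝 t, u₁ τ = u₂ τ) (x : E) : p₁ t x - p₁ t 0 = p₂ t x - p₂ t 0 := by
  have hd₁ : Differentiable ℝ (p₁ t) :=
    (h₁.contDiff_pressure (mem_of_mem_nhds ht₁)).differentiable (by simp)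
  have hd₂ : Differentiable ℝ (p₂ t) :=
    (h₂.contDiff_pressure (mem_of_mem_nhds ht₂)).differentiable (by simp)
  have hdiff : Differentiable ℝ (fun y => p₁ t y - p₂ t y) := hd₁.sub hd₂
  have hzero : ∀ y, fderiv ℝ (fun y => p₁ t y - p₂ t y) y = 0 := by
    intro y
    rw [fderiv_fun_sub (hd₁ y) (hd₂ y)]
    have hg := h₁.gradient_pressure_eq_of_eventuallyEq h₂ ht₁ ht₂ heq y
    unfold gradient at hg
    rw [(InnerProductSpace.toDual ℝ E).symm.injective hg, sub_self]
  have hc := is_const_of_fderiv_eq_zero hdiff hzero x 0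
  -- `hc : p₁ t x - p₂ t x = p₁ t 0 - p₂ t 0`
  linarith

/-- **Gluing classical solutions along an open overlap.** Let `(u₁, p₁)` be a classical
solution on `[0, T)` and `(u₂, p₂)` a classical solution on `(a, b)` (same viscosity and force),
`0 ≤ a < T ≤ b`, with `u₁(t) = u₂(t)` for `t ∈ (a, T)`. Then the velocity equal to `u₁` for
`t < T` and to `u₂` for `t ≥ T`, with the normalised pressure `p₁ - p₁(·, 0)` resp.
`p₂ - p₂(·, 0)`, is a classical solution on `[0, b)`. Joint smoothness is local: `[0, T) × E`
and `(a, b) × E` are relatively open in `[0, b) × E`, and on them the glued fields coincide with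
`(u₁, p₁ - p₁(·,0))` resp. `(u₂, p₂ - p₂(·,0))` — for the pressures by
`pressure_sub_apply_zero_eq_of_eventuallyEq` on the overlap `(a, T)`. The momentum equation at
`t < T` is that of `(u₁, p₁)` (near `t` the glued velocity is `u₁` and `[0, b)` coincides with
`[0, T)`), at `t ≥ T` that of `(u₂, p₂)` (interior time, two-sided derivatives). [folklore] -/
theorem IsClassicalNSSolutionOn.glue {T a b : ℝ} {f u₁ u₂ : ℝ → E → E} {p₁ p₂ : ℝ → E → ℝ}
    (h₁ : IsClassicalNSSolutionOn (Ico 0 T) ν f u₁ p₁)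
    (h₂ : IsClassicalNSSolutionOn (Ioo a b) ν f u₂ p₂) (ha : 0 ≤ a) (haT : a < T) (hTb : T ≤ b)
    (heq : ∀ t ∈ Ioo a T, u₁ t = u₂ t) :
    IsClassicalNSSolutionOn (Ico 0 b) ν f (fun t => if t < T then u₁ t else u₂ t)
      (fun t => if t < T then (fun x => p₁ t x - p₁ t 0) else fun x => p₂ t x - p₂ t 0) := by
  -- the two relatively open pieces of `[0, b)`
  have hI₁ : Ico 0 b ∩ Iio T = Ico 0 T := by
    ext τ
    simp only [mem_inter_iff, mem_Ico, mem_Iio]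
    exact ⟨fun h => ⟨h.1.1, h.2⟩, fun h => ⟨⟨h.1, h.2.trans_le hTb⟩, h.2⟩⟩
  have hI₂ : Ico 0 b ∩ Ioi a = Ioo a b := by
    ext τ
    simp only [mem_inter_iff, mem_Ico, mem_Ioi, mem_Ioo]
    exact ⟨fun h => ⟨h.2, h.1.2⟩, fun h => ⟨⟨ha.trans h.1.le, h.2⟩, h.1⟩⟩
  have hP₁ : (Ico 0 b ×ˢ (univ : Set E)) ∩ Iio T ×ˢ univ = Ico 0 T ×ˢ univ := by
    rw [prod_inter_prod, hI₁, inter_self]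
  have hP₂ : (Ico 0 b ×ˢ (univ : Set E)) ∩ Ioi a ×ˢ univ = Ioo a b ×ˢ univ := by
    rw [prod_inter_prod, hI₂, inter_self]
  -- on the overlap the velocities agree near every point and the normalised pressures agree
  have hov : ∀ t ∈ Ioo a T, ∀ᶠ τ in 𝓝 t, u₁ τ = u₂ τ := fun t ht => by
    filter_upwards [Ioo_mem_nhds ht.1 ht.2] with τ hτ using heq τ hτ
  have hpr : ∀ t ∈ Ioo a T, ∀ x, p₁ t x - p₁ t 0 = p₂ t x - p₂ t 0 := fun t ht x =>
    h₁.pressure_sub_apply_zero_eq_of_eventuallyEq h₂ (Ico_mem_nhds (ha.trans_lt ht.1) ht.2)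
      (Ioo_mem_nhds ht.1 (ht.2.trans_le hTb)) (hov t ht) x
  refine ⟨?_, ?_, ?_, ?_⟩
  · -- smoothness of the glued velocity
    refine contDiffOn_of_locally_contDiffOn fun z hz => ?_
    obtain ⟨t, x⟩ := z
    have ht : t ∈ Ico 0 b := hz.1
    by_cases htT : t < T
    · refine ⟨Iio T ×ˢ univ, isOpen_Iio.prod isOpen_univ, ⟨htT, mem_univ _⟩, ?_⟩
      rw [hP₁]
      refine h₁.smooth_velocity.congr fun z hz => ?_
      obtain ⟨τ, y⟩ := z
      have hτ : τ < T := hz.1.2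
      simp only [uncurry_apply_pair, if_pos hτ]
    · refine ⟨Ioi a ×ˢ univ, isOpen_Ioi.prod isOpen_univ, ⟨haT.trans_le (not_lt.1 htT), mem_univ _⟩,
        ?_⟩
      rw [hP₂]
      refine h₂.smooth_velocity.congr fun z hz => ?_
      obtain ⟨τ, y⟩ := z
      have hτ : τ ∈ Ioo a b := hz.1
      by_cases hτT : τ < T
      · simp only [uncurry_apply_pair, if_pos hτT, heq τ ⟨hτ.1, hτT⟩]
      · simp only [uncurry_apply_pair, if_neg hτT]
  · -- smoothness of the glued (normalised) pressure
    refine contDiffOn_of_locally_contDiffOn fun z hz => ?_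
    obtain ⟨t, x⟩ := z
    have ht : t ∈ Ico 0 b := hz.1
    by_cases htT : t < T
    · refine ⟨Iio T ×ˢ univ, isOpen_Iio.prod isOpen_univ, ⟨htT, mem_univ _⟩, ?_⟩
      rw [hP₁]
      refine h₁.smooth_pressure.sub_apply_zero.congr fun z hz => ?_
      obtain ⟨τ, y⟩ := z
      have hτ : τ < T := hz.1.2
      simp only [uncurry_apply_pair, if_pos hτ]
    · refine ⟨Ioi a ×ˢ univ, isOpen_Ioi.prod isOpen_univ, ⟨haT.trans_le (not_lt.1 htT), mem_univ _⟩,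
        ?_⟩
      rw [hP₂]
      refine h₂.smooth_pressure.sub_apply_zero.congr fun z hz => ?_
      obtain ⟨τ, y⟩ := z
      have hτ : τ ∈ Ioo a b := hz.1
      by_cases hτT : τ < T
      · simp only [uncurry_apply_pair, if_pos hτT, hpr τ ⟨hτ.1, hτT⟩ y]
      · simp only [uncurry_apply_pair, if_neg hτT]
  · -- the momentum equation
    intro t ht x
    obtain ⟨h0t, htb⟩ := ht
    by_cases htT : t < T
    · have hev : (fun τ => (if τ < T then u₁ τ else u₂ τ) x) =ᶠ[𝓝 t] fun τ => u₁ τ x := by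
        filter_upwards [Iio_mem_nhds htT] with τ hτ
        rw [if_pos (show τ < T from hτ)]
      have hD : timeDerivWithin (Ico 0 b) (fun τ => if τ < T then u₁ τ else u₂ τ) t x =
          timeDerivWithin (Ico 0 T) u₁ t x := by
        simp only [timeDerivWithin_apply]
        rw [(hev.filter_mono nhdsWithin_le_nhds).derivWithin_eq (by rw [if_pos htT]), ← hI₁,
          derivWithin_inter (Iio_mem_nhds htT)]
      rw [hD]
      simp only [if_pos htT]
      rw [gradient_sub_const]
      exact h₁.momentum t ⟨h0t, htT⟩ x
    · have hTt : T ≤ t := not_lt.1 htT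
      have hat : a < t := haT.trans_le hTt
      have hev : (fun τ => (if τ < T then u₁ τ else u₂ τ) x) =ᶠ[𝓝 t] fun τ => u₂ τ x := by
        filter_upwards [Ioi_mem_nhds hat] with τ hτ
        by_cases hτT : τ < T
        · rw [if_pos hτT, heq τ ⟨hτ, hτT⟩]
        · rw [if_neg hτT]
      have hD : timeDerivWithin (Ico 0 b) (fun τ => if τ < T then u₁ τ else u₂ τ) t x =
          timeDerivWithin (Ioo a b) u₂ t x := by
        simp only [timeDerivWithin_apply]
        rw [(hev.filter_mono nhdsWithin_le_nhds).derivWithin_eq (by rw [if_neg htT]),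
          derivWithin_of_mem_nhds (Ico_mem_nhds (ha.trans_lt hat) htb),
          derivWithin_of_mem_nhds (Ioo_mem_nhds hat htb)]
      rw [hD]
      simp only [if_neg htT]
      rw [gradient_sub_const]
      exact h₂.momentum t ⟨hat, htb⟩ x
  · -- incompressibility
    intro t ht
    by_cases htT : t < T
    · simp only [if_pos htT]
      exact h₁.divFree t ⟨ht.1, htT⟩
    · simp only [if_neg htT]
      exact h₂.divFree t ⟨haT.trans_le (not_lt.1 htT), ht.2⟩

/-! ### Maximality of the lifespan is inherited by time translates -/

/-- **Extension past `T - s` of the translate gives extension past `T`.** Let `(u, p)` be a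
classical solution on `[0, T)` and `0 < s < T`. If the translate `u(· + s)` (a classical
solution on `[0, T - s)` with force `f(· + s)`) extends smoothly past `T - s`, then `u` extends
smoothly past `T`: translate the extension back by `-s` to a classical solution on `(s, T' + s)`
agreeing with `u` on `(s, T)`, and glue it to `u` (`IsClassicalNSSolutionOn.glue`)
(Beale–Kato–Majda 1984, §1). [cite: BealeKatoMajda1984, §1] -/
theorem HasSmoothExtensionPast.of_translate {T s : ℝ} {f u : ℝ → E → E} {p : ℝ → E → ℝ}
    (h : IsClassicalNSSolutionOn (Ico 0 T) ν f u p) (hs : 0 < s) (hsT : s < T)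
    (hext : HasSmoothExtensionPast ν (fun t => f (t + s)) (fun t => u (t + s)) (T - s)) :
    HasSmoothExtensionPast ν f u T := by
  obtain ⟨T', hT', w, q, hw, hweq⟩ := hext
  -- translate the extension back by `-s`
  have hw' := hw.comp_add_right (-s)
  have hf : (fun t => f (t + -s + s)) = f := by
    funext t
    rw [neg_add_cancel_right]
  rw [hf] at hw'
  have hw₂ : IsClassicalNSSolutionOn (Ioo s (T' + s)) ν f (fun t => w (t + -s))
      (fun t => q (t + -s)) :=
    hw'.mono (fun t ht => ⟨by linarith [ht.1], by linarith [ht.2]⟩) isOpen_Ioo.uniqueDiffOn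
  -- the two velocities agree on the overlap `(s, T)`
  have heq : ∀ t ∈ Ioo s T, u t = w (t + -s) := by
    intro t ht
    rw [hweq (t + -s) ⟨by linarith [ht.1], by linarith [ht.2]⟩]
    simp
  refine ⟨T' + s, by linarith, _, _, h.glue hw₂ hs.le hsT (by linarith) heq, fun t ht => ?_⟩
  simp only [if_pos ht.2]

/-- **Time translates of maximal smooth solutions are maximal.** If `(u, p)` is a maximal
smooth solution with lifespan `T` and `0 < s < T`, then `(u(· + s), p(· + s))` is a maximal
smooth solution with lifespan `T - s` for the force `f(· + s)`
(`IsClassicalNSSolutionOn.translate_Ico` and `HasSmoothExtensionPast.of_translate`;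
Beale–Kato–Majda 1984, §1). [cite: BealeKatoMajda1984, §1] -/
theorem IsMaximalSmoothSolution.translate {T s : ℝ} {f u : ℝ → E → E} {p : ℝ → E → ℝ}
    (h : IsMaximalSmoothSolution ν f u p T) (hs : 0 < s) (hsT : s < T) :
    IsMaximalSmoothSolution ν (fun t => f (t + s)) (fun t => u (t + s)) (fun t => p (t + s))
      (T - s) :=
  ⟨h.1.translate_Ico hs.le, fun hext => h.2 (HasSmoothExtensionPast.of_translate h.1 hs hsT hext)⟩

/-- The unforced case of `IsMaximalSmoothSolution.translate` (the force `0` is translation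
invariant). [cite: BealeKatoMajda1984, §1] -/
theorem IsMaximalSmoothSolution.translate_zero {T s : ℝ} {u : ℝ → E → E} {p : ℝ → E → ℝ}
    (h : IsMaximalSmoothSolution ν 0 u p T) (hs : 0 < s) (hsT : s < T) :
    IsMaximalSmoothSolution ν 0 (fun t => u (t + s)) (fun t => p (t + s)) (T - s) :=
  h.translate hs hsT

/-- The unforced case of `IsClassicalNSSolutionOn.translate_Ico`. [folklore] -/
theorem IsClassicalNSSolutionOn.translate_Ico_zero {T s : ℝ} {u : ℝ → E → E} {p : ℝ → E → ℝ}
    (h : IsClassicalNSSolutionOn (Ico 0 T) ν 0 u p) (hs : 0 ≤ s) :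
    IsClassicalNSSolutionOn (Ico 0 (T - s)) ν 0 (fun t => u (t + s)) (fun t => p (t + s)) :=
  h.translate_Ico hs

end Glue

end Literature.Analysis.FluidPDE

end
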